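import Literature.MathematicalPhysics.QuantumFieldTheory.King1986.ContinuumLimitStatements
import Literature.MathematicalPhysics.QuantumFieldTheory.Balaban1983to89.B1
import HarnessLib

/-!
# King 1986 II, §2 and §4 AS PRINTED: the cubes `C_J` (2.7), the torus `D_J` (4.1), the two lattices of Fig. 1
# (angle `θ₀ = tan⁻¹(3/4)`, spacings `ε` and `5ε`), the expectations (2.20)–(2.21), **Theorem 2.4 (2.22)–(2.23)**,
# Proposition 4.1 (4.5), Theorem 4.2 (4.6) — with (2.23) «θ₀/2π is irrational» PROVED by King's own argument (4.10)–(4.13)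
# and the deduction (4.7)–(4.9) «Theorem 2.4 follows» PROVED over the schema

statement-level skeleton of published theorems with citation tags; proofs where landed; nothing here is a claim about the Yang–Mills mass gap

C. King, *The U(1) Higgs model. II. The infinite volume limit*, Commun. Math. Phys. **103** (1986) 323–349 [King1986II],
§2 pp. 324–328, §4 pp. 336–338.  PDF held: `paper:king1986-cmp103-king-u1-higgs-ii` (journal page = PDF page + 322).  Page
renders read AS IMAGES for every quotation below: `run/shared/lean/pub/ym3-torus/renders/king1986-cmp103-II/original-p004/p005-x2.png`
(pp. 326–327: Theorems 2.1–2.4, Fig. 1), `run/shared/lean/pub/pub-balaban/b2b-balaban-summit-lit2/renders/1986-cmp103-king-u1-higgs-II-p015-x2.png`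
(p. 337) and the seat's own CCITT renders of PDF pp. 14, 16 (pp. 336, 338).  Companion file (imported):
`King1986/ContinuumLimitStatements` = [King1986] (CMP **102**) §2.3–§3.2, whose torus (2.21) `Torus221`, spacings `eps L K = L^{−K}`,
renormalization-group schema `RGData` with `Thm31Printed`/`Thm34Printed`/`UVStable`, the choice (3.12) `kChoice` and the Cauchy
device (3.10)–(3.13) are REUSED here by name (King II p. 337: *"using the results of [Ba 2] (as stated in Theorem 3.1 of [K 1])"*,
*"Theorem 2.4 follows (see Sect. 3.2 of [K 1])"*).

CITATION HEADER (lean-in-tree rule).  Typed for the cell `lit-balaban` (seat `lit-balaban-type-King86`, R141 (B)) as the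
Literature declaration behind the ladder's spine crux `stmt-QuantumFields-20042` (`Summits/…/Theorems/BalabanLadderROTDefs.lean`
`KingSingle`: *"the (3,4,5) lattice pair of C. King, CMP 103 (1986) Thm 2.4 — ONE two-lattice comparison"*) and the N15 node's
King citations.  Before this file the tree had NO declaration of Theorem 2.4; the Summits-side helpers
`Summit.…ROT.cos_arcsin_three_fifths` / `irrational_arcsin_three_fifths_div_two_pi` (Niven route) live in the `Summit` namespace,
which Literature cannot import, and are not restated: here (2.23) is proved the way KING proves it ((4.10)–(4.13): Chebyshev
polynomial, leading coefficient `2^{q−1}`, rational-root theorem), for `θ₀ := arctan (3/4)` with the bridge `theta0_eq_arcsin :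
θ₀ = arcsin (3/5)` to the Summits spelling.  WHAT IS REPRODUCED, and how:
* §0 **(2.7)** `C_J`, **(4.1)** `D_J` (`cubeC`, `boxD`), `D_J` as a (2.21)-torus of [K I] (`torusD : Torus221 d`, half-sides `25MJ`,
  `2L_μM⁻¹ = 50J ∈ ℕ`; `|D_J| = (50MJ)^d`), **(2.8)** `ε_K = L^{−K}` with `L = 5` (`ContinuumLimit.eps 5 K`; `5ε_{K+1} = ε_K`, so the
  coarse rotated lattice `R(5ε_K)` IS `R(ε_{K−1})`), and p. 327 *"the length of each side of D_J is a multiple of 25"* in units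
  of `25ε_K` (PROVED).
* §1 p. 326 *"The angle between the lattices is θ₀ = tan⁻¹(3/4)"*: `theta0`, `cos θ₀ = 4/5`, `sin θ₀ = 3/5`; Fig. 1 in the
  `(x_μ, x_ν)`-plane read as `ℂ` with MATHLIB's rotation `rotation (Circle.exp θ₀)` (no new notion of rotation is declared):
  `5e^{iθ₀} = 4 + 3i`, hence `R_{θ₀}` maps the lattice `5εℤ[i]` INTO `εℤ[i]` (*"Each lattice site y in T_{R(5ε)} defines a block
  of 5^d sites on T_ε"*, p. 336) and the period vectors `50MJ`, `50MJ·i` of `D_J` are rotated-lattice vectors (*"D_J is also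
  fitted by the rotated lattice"*, p. 327) — PROVED; p. 328 *"By iterating the rotation … and using the fact that θ₀/2π is
  irrational, we generate all rotations in the μν-plane"* as density of `ℤθ₀ + 2πℤ` (Mathlib `dense_addSubgroupClosure_pair_iff`).
* §2 **(2.23) PROVED following (4.10)–(4.13)** pp. 337–338 (`irrational_theta0_div_two_pi`), with the printed intermediate claims
  as lemmas: (4.10)/(4.12) `cos θ₀` is a root of `T_q − 1`, an integer polynomial with leading coefficient `2^{q−1}`; (4.13) a
  rational root `M/N` has `N ∣ 2^{q−1}`; `3/5` (as printed on p. 337) and `4/5` (what `tan⁻¹(3/4)` of p. 326 gives — the text's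
  *"We know that cos θ₀ = 3/5"* is `sin θ₀`; the argument is the same for either, and both are proved) are not roots.
* §3 **(4.3)–(4.4)** the modified (rotated-block) averaging operators, as instances of the tree's `Balaban1983to89.B1.blockAvg`
  with weight `5^{−d}`.
* §4 **THEOREM 2.4 AS PRINTED**: `Thm24Data` (the torus `D_J` and the two families of P-b.c. expectations (2.20), (2.21) of the
  observables `O(zg, wh)` (2.14), as `ℂ`-valued sequences in `K`), `Eq222` (2.22), `Thm24Printed := Eq222 ∧ (2.23)`, and
  `thm24Printed_iff : Thm24Printed T ↔ T.Eq222` ((2.23) being a theorem).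
* §5 **§4 AS SCHEMA, THE DEDUCTION PROVED**: `RotData` (the objects of pp. 336–337), (4.2) `UV42`, Proposition 4.1 (4.5)
  `Prop41Printed`, Theorem 4.2 (4.6) `Thm42Printed`, the *"analogues of Proposition 4.1 and Theorem 4.2"* of the switched
  argument (`Prop41Mirror`, `Thm42Mirror`) — hypothesis schemas (Sect. 5 / App. B of [K II] prove them; not reproduced) — and
  PROVED: the one-sided device (4.7)–(4.9) for an arbitrary measure space (`sub_le_of_oneSided_bounds`), its quantitative form
  at `k = [2βK(2β+γ)⁻¹]` (`Core.oneSided`: a geometric rate `L^{−aK}`), *"switching around the argument"* and *"Then using the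
  bound (4.9) and choosing k suitably, Theorem 2.4 follows"* at the level of the generating functionals:
  `RotData.tendsto_rot_sub_std` (`Z^{R(5ε_K)}(D_J,g,h) − Z^{ε_K}(D_J,g,h) → 0`), `tendsto_rot_of_tendsto_std`, and with [K I]
  Theorem 2.1 (i) for the axis model (FILE A's `RGData.hasContinuumLimit_of_thm31_thm34`) `limits_agree : ∃ Z, Z^{ε_K} → Z ∧
  Z^{R(ε_K)} → Z`; expectations are ratios of generating functionals (`expectations_agree`, `limit_pos_of_uv42`).

HONEST SCOPE.  Proposition 4.1, Theorem 4.2, their mirror analogues, (4.2) and [K I] Theorems 3.1/3.4 are HYPOTHESES (schemas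
over abstract data: King's effective actions, measures and block operators are not constructed).  §4 of the paper proves (2.22)
for the REAL generating functionals `Z^{ε}(D_J, g, h)`; the printed Theorem 2.4 has `z, w ∈ ℂ`, and the passage to complex
parameters (Vitali's theorem, as in §3 of [K II]) is by reference in print and is NOT proved here — `Eq222` stays a schema and
no theorem of this file produces it.  Theorems 2.1–2.3 of [K II] (N/D b.c., infinite volume, OS properties) and Sect. 5 /
Appendices are not typed here (App. B (B.9)–(B.11) is `King1986/RotatedSchemeSymbol`).  (2.24)–(2.25) are printed as an
EXPECTATION (*"we can expect that a cluster expansion would give"*) and are not typed as facts.  `d = 2, 3`; finite torus;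
nothing here bears on Bałaban's 4-d Yang–Mills papers, infinite volume, a mass gap, or the Clay problem; count-neutral for the
ladder (no node discharged).
-/

noncomputable section

open Real Filter Topology MeasureTheory Finset

namespace Literature.MathematicalPhysics.QuantumFieldTheory.King1986.RotationInvariance

open Literature.MathematicalPhysics.QuantumFieldTheory.King1986.ContinuumLimit

/-! ## §0 The cubes `C_J` (2.7), the torus `D_J` (4.1), the spacings `ε_K = L^{−K}` (2.8) with `L = 5` -/

/-- **(2.7)** p. 325 [PDF 3], verbatim: *"For definiteness, we take Ω to be a rectangular parallelepiped with equal sides. Define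
for integer J, C_J = {x ∈ ℝ^d : −MJ ≤ x_μ < MJ, μ = 1, …, d}, (2.7) where M is the large integer used in Sect. 2.3 of [K1]."*
[cite: King1986II, (2.7) p.325] -/
def cubeC (d M J : ℕ) : Set (Fin d → ℝ) := {x | ∀ μ, -((M : ℝ) * J) ≤ x μ ∧ x μ < (M : ℝ) * J}

/-- **(4.1)** p. 336 [PDF 14], verbatim: *"As explained in Sect. 2, in this section we will consider the model on a torus D_J
defined by D_J = {x ∈ ℝ^d : −25MJ ≤ x_μ < 25MJ, μ = 1, …, d}. (4.1)"*; p. 326: *"We define a torus D_J by (2.7) with M replaced by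
25M."*  Typed literally as `C_J` with `25M`. [cite: King1986II, (4.1) p.336] -/
def boxD (d M J : ℕ) : Set (Fin d → ℝ) := cubeC d (25 * M) J

/-- Unfolding of (4.1). [cite: King1986II, (4.1) p.336] -/
theorem boxD_eq (d M J : ℕ) :
    boxD d M J = {x | ∀ μ, -(25 * (M : ℝ) * J) ≤ x μ ∧ x μ < 25 * (M : ℝ) * J} := by
  simp [boxD, cubeC]

/-- **`D_J` is a torus (2.21) of [K I]** (p. 326: *"Our solution of this problem is to use periodic boundary conditions. We
define a torus D_J by (2.7) with M replaced by 25M. For L = 5, we can "fit" D_J by lattices with the same orientation as the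
sides of D_J and with lattice spacings ε_K = L^{−K}"*): half-sides `L_μ = 25MJ`, large-block integer `M`, and the [K I] (2.21)
requirement `2L_μM⁻¹ ∈ ℕ` holds with `2L_μM⁻¹ = 50J` (PROVED in the `fit` field).  So every [K I] schema over `Torus221`
(Theorem 2.1 `Thm21Printed`, …) applies to `D_J`. [cite: King1986II, (4.1) p.336; King1986, (2.21) p.654] -/
def torusD (d : ℕ) {M J : ℕ} (hM : 0 < M) (hJ : 0 < J) : Torus221 d where
  M := M
  M_pos := hM
  side := fun _ => 25 * M * J
  side_pos := fun _ => by
    have hM' : (0 : ℝ) < M := by exact_mod_cast hM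
    have hJ' : (0 : ℝ) < J := by exact_mod_cast hJ
    positivity
  fit := fun _ => ⟨50 * J, by push_cast; ring⟩

/-- The carrier of the torus `D_J` is the box (4.1). [cite: King1986II, (4.1) p.336] -/
theorem torusD_carrier (d : ℕ) {M J : ℕ} (hM : 0 < M) (hJ : 0 < J) :
    (torusD d hM hJ).carrier = boxD d M J := by
  ext x
  simp [Torus221.carrier, torusD, boxD, cubeC, mul_assoc]

/-- `|D_J| = (50MJ)^d` (the volume factor `|D_J|` of (4.2), (4.5)–(4.9)). [cite: King1986II, (4.2) p.336] -/
theorem torusD_vol (d : ℕ) {M J : ℕ} (hM : 0 < M) (hJ : 0 < J) :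
    (torusD d hM hJ).vol = (50 * (M : ℝ) * J) ^ d := by
  simp [Torus221.vol, torusD, Finset.prod_const]
  ring

/-- **(2.8)** p. 325 [PDF 3], verbatim: *"As before, we define lattice spacings {ε_K}, K = 0, …, ∞, by ε_K = L^{−K}, (2.8) where L
is the small integer which determines the size of the blocks used in the renormalization transformation."*  This IS [K I]'s
`ContinuumLimit.eps L K` (reused); in §4 `L = 5` (p. 327: *"Again taking L = 5, and ε_K = L^{−K}"*): `ε_K = 5^{−K}`.
[cite: King1986II, (2.8) p.325] -/
theorem eps_five (K : ℕ) : eps 5 K = ((5 : ℝ) ^ K)⁻¹ := rfl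

/-- `5ε_{K+1} = ε_K` for `L = 5`: the coarse lattice of Fig. 1 at spacing `5ε_K` is the lattice of spacing `ε_{K−1}`, so the
rotated family `⟨·⟩^{R(ε_K), D_J}` (2.21) at index `K − 1` is the model `Z^{R(5ε)}` of §4 with `ε = ε_K`.
[cite: King1986II, (2.21) p.327] -/
theorem five_mul_eps_succ (K : ℕ) : 5 * eps 5 (K + 1) = eps 5 K := by
  have h := pow_mul_eps (L := 5) (by norm_num) (k := 1) (K := K + 1) (by omega)
  simpa using h

/-- p. 327 [PDF 5], verbatim: *"From Fig. 1, and since the length of each side of D_J is a multiple of 25, we see that D_J is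
also fitted by the rotated lattice."* — PROVED in the form: the side `50MJ` of `D_J` is the integer multiple `2MJ·5^K` of
`25ε_K`, for every `K`. [cite: King1986II, (2.21) p.327] -/
theorem side_eq_mul_coarse (M J K : ℕ) :
    (50 * (M : ℝ) * J) = ((2 * M * J * 5 ^ K : ℕ) : ℝ) * (25 * eps 5 K) := by
  rw [eps_five]
  push_cast
  field_simp
  ring

/-! ## §1 King's angle `θ₀ = tan⁻¹(3/4)` and the two lattices of Fig. 1 -/

/-- **King's angle**, p. 326 [PDF 4], verbatim: *"In order to prove rotation invariance, it is sufficient to show that the limit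
⟨O(zg, wh)⟩ is the same when constructed from two sequences of lattices whose orientations differ by an angle θ₀
incommensurate with 2π. The two lattices we use are illustrated in Fig. 1. One lattice has spacing ε, the other has spacing 5ε.
The angle between the lattices is θ₀ = tan⁻¹(3/4). For d > 2, the lattices have the same orientation in the other d − 2
coordinate directions not shown in Fig. 1."* [cite: King1986II, p.326] -/
def theta0 : ℝ := Real.arctan (3 / 4)

/-- `√(1 + (3/4)²) = 5/4` — the `(3,4,5)` triangle. [cite: King1986II, p.326] -/
theorem sqrt_one_add_sq : √(1 + (3 / 4 : ℝ) ^ 2) = 5 / 4 := by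
  rw [show (1 : ℝ) + (3 / 4) ^ 2 = (5 / 4) ^ 2 by norm_num]
  exact Real.sqrt_sq (by norm_num)

/-- `cos θ₀ = 4/5` for `θ₀ = tan⁻¹(3/4)` (p. 337 writes *"We know that cos θ₀ = 3/5"* — that is `sin θ₀`; the irrationality
argument (4.10)–(4.13) is literally the same for either value, see `not_root_three_fifths`, `not_root_four_fifths`).
[cite: King1986II, p.326, p.337] -/
theorem cos_theta0 : Real.cos theta0 = 4 / 5 := by
  rw [theta0, Real.cos_arctan, sqrt_one_add_sq]; norm_num

/-- `sin θ₀ = 3/5`. [cite: King1986II, p.326] -/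
theorem sin_theta0 : Real.sin theta0 = 3 / 5 := by
  rw [theta0, Real.sin_arctan, sqrt_one_add_sq]; norm_num

/-- `tan θ₀ = 3/4`, as printed. [cite: King1986II, p.326] -/
theorem tan_theta0 : Real.tan theta0 = 3 / 4 := by
  rw [theta0, Real.tan_arctan]

/-- `θ₀ = arcsin (3/5)` — the spelling used on the Summits side (`KingSingle`: *"θ₀ = arcsin (3/5) (cos θ₀ = 4/5: the (3,4,5)
lattice pair)"*). [cite: King1986II, p.326] -/
theorem theta0_eq_arcsin : theta0 = Real.arcsin (3 / 5) := by
  rw [theta0, Real.arctan_eq_arcsin, sqrt_one_add_sq]; norm_num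

/-- `0 < θ₀`. [cite: King1986II, p.326] -/
theorem theta0_pos : 0 < theta0 := by
  rw [theta0]; exact Real.arctan_pos.2 (by norm_num)

/-- `θ₀ < π/2`. [cite: King1986II, p.326] -/
theorem theta0_lt_pi_div_two : theta0 < π / 2 := by
  rw [theta0]; exact Real.arctan_lt_pi_div_two _

/-- **Fig. 1 in the complex plane**: reading the `(x_μ, x_ν)`-plane of Fig. 1 (p. 327) as `ℂ`, the rotation `R_{θ₀}` is
multiplication by `e^{iθ₀}`, and `e^{iθ₀} = (4 + 3i)/5`. [cite: King1986II, Fig. 1 p.327] -/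
theorem exp_theta0_mul_I : Complex.exp (theta0 * Complex.I) = (4 + 3 * Complex.I) / 5 := by
  rw [Complex.exp_mul_I, ← Complex.ofReal_cos, ← Complex.ofReal_sin, cos_theta0, sin_theta0]
  push_cast
  ring

/-- `R_{θ₀} z = ((4 + 3i)/5)·z`, with Mathlib's rotation `rotation (Circle.exp θ₀) : ℂ ≃ₗᵢ[ℝ] ℂ` of the plane.
[cite: King1986II, Fig. 1 p.327] -/
theorem rotation_theta0_apply (z : ℂ) :
    rotation (Circle.exp theta0) z = (4 + 3 * Complex.I) / 5 * z := by
  rw [rotation_apply, Circle.coe_exp, exp_theta0_mul_I]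

/-- **The rotated lattice of spacing `5` sits inside the axis lattice of spacing `1`** (Fig. 1; p. 336: *"Each lattice site y in
T_{R(5ε)} defines a block of 5^d sites on T_ε"*): `R_{θ₀}(5(a + bi)) = (4a − 3b) + (3a + 4b)i ∈ ℤ[i]` for `a, b ∈ ℤ`.
[cite: King1986II, Fig. 1 p.327, p.336] -/
theorem rotation_theta0_coarse (a b : ℤ) :
    rotation (Circle.exp theta0) (5 * (a + b * Complex.I))
      = ((4 * a - 3 * b : ℤ) : ℂ) + ((3 * a + 4 * b : ℤ) : ℂ) * Complex.I := by
  rw [rotation_theta0_apply]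
  push_cast
  ring_nf
  rw [Complex.I_sq]
  ring

/-- The same at spacing `ε`: `R_{θ₀}(5ε·ℤ[i]) ⊆ ε·ℤ[i]` (*"One lattice has spacing ε, the other has spacing 5ε"*, p. 326).
[cite: King1986II, Fig. 1 p.327] -/
theorem rotation_theta0_coarse_scaled (ε : ℝ) (a b : ℤ) :
    rotation (Circle.exp theta0) ((5 * ε : ℝ) * (a + b * Complex.I))
      = (ε : ℂ) * (((4 * a - 3 * b : ℤ) : ℂ) + ((3 * a + 4 * b : ℤ) : ℂ) * Complex.I) := by
  rw [rotation_theta0_apply]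
  push_cast
  ring_nf
  rw [Complex.I_sq]
  ring

/-- **`D_J` is fitted by the rotated lattice**, first period vector (p. 327: *"since the length of each side of D_J is a
multiple of 25, we see that D_J is also fitted by the rotated lattice"*): `50MJ = R_{θ₀}(5·((8MJ) − (6MJ)i))`, a vector of the
rotated lattice of spacing `5` (hence of spacing `5ε_K` for every `K`, as `5 = 5^{K}·5ε_K`). [cite: King1986II, (2.21) p.327] -/
theorem period_fst (M J : ℕ) :
    rotation (Circle.exp theta0) (5 * ((8 * M * J : ℤ) + (-(6 * M * J) : ℤ) * Complex.I))
      = (50 * M * J : ℕ) := by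
  rw [rotation_theta0_apply]
  push_cast
  ring_nf
  rw [Complex.I_sq]
  ring

/-- Second period vector: `50MJ·i = R_{θ₀}(5·((6MJ) + (8MJ)i))`. [cite: King1986II, (2.21) p.327] -/
theorem period_snd (M J : ℕ) :
    rotation (Circle.exp theta0) (5 * ((6 * M * J : ℤ) + (8 * M * J : ℤ) * Complex.I))
      = (50 * M * J : ℕ) * Complex.I := by
  rw [rotation_theta0_apply]
  push_cast
  ring_nf
  rw [Complex.I_sq]
  ring

/-- p. 328 [PDF 6], verbatim: *"By iterating the rotation R_{μν} and using the fact that θ₀/2π is irrational, we generate all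
rotations in the μν-plane."* — PROVED as: the additive subgroup of `ℝ` generated by `θ₀` and `2π` is dense (Mathlib
`dense_addSubgroupClosure_pair_iff`; the irrationality is `irrational_theta0_div_two_pi` below, taken here as the hypothesis so
that §1 does not depend on §2). [cite: King1986II, p.328] -/
theorem dense_closure_theta0_two_pi (h : Irrational (theta0 / (2 * π))) :
    Dense ((AddSubgroup.closure ({theta0, 2 * π} : Set ℝ) : AddSubgroup ℝ) : Set ℝ) :=
  dense_addSubgroupClosure_pair_iff.2 h

/-! ## §2 (2.23) «θ₀/2π is irrational» — PROVED by King's argument (4.10)–(4.13), pp. 337–338 -/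

open Polynomial in
/-- **(4.10)**, p. 337 [PDF 15], verbatim: *"It remains to prove that θ₀/2π is irrational. We know that cos θ₀ = 3/5. So suppose
that θ₀ = (p/q)2π, where p, q are integers. Then 1 = cos qθ₀ = (cos θ₀)^q Σ_{n=0}^{q/2} C(q, 2n) + P_{q−2}(cos θ₀) … (4.10) where
P_{q−2}, P′_{q−2} are polynomials of degree q − 2."* — PROVED in the form: if `qθ = 2πp` then `T_q(cos θ) = cos qθ = 1`, `T_q`
the Chebyshev polynomial (Mathlib `Polynomial.Chebyshev.T`, `T_real_cos`; King's expansion (4.10)–(4.11) is the computation of its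
leading coefficient, `leadingCoeff_T_sub_one`). [cite: King1986II, (4.10) p.337] -/
theorem chebyshev_eval_cos_eq_one {θ : ℝ} {p : ℤ} {q : ℕ} (h : θ * q = p * (2 * π)) :
    (Polynomial.Chebyshev.T ℝ q).eval (Real.cos θ) = 1 := by
  rw [Polynomial.Chebyshev.T_real_cos]
  have : ((q : ℤ) : ℝ) * θ = (p : ℝ) * (2 * π) := by push_cast; rw [mul_comm]; exact h
  rw [this]
  exact Real.cos_int_mul_two_pi p

open Polynomial in
/-- **(4.11)–(4.12)**, p. 338 [PDF 16], verbatim: *"It is easy to show that Σ_{n=0}^{q/2} C(q, 2n) = Σ_{n=0}^{(q−1)/2} C(q, 2n+1) =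
2^{q−1}. (4.11) Therefore, for some integers a₀, …, a_{q−1}, cos θ₀ is a solution of the equation 2^{q−1}x^q + Σ_{n=0}^{q−1} a_n
x^n = 0. (4.12)"* — PROVED as: for `q ≥ 1` the integer polynomial `T_q − 1` has leading coefficient `2^{q−1}` (Mathlib
`Chebyshev.leadingCoeff_T`, `degree_T`). [cite: King1986II, (4.11)–(4.12) p.338] -/
theorem leadingCoeff_T_sub_one {q : ℕ} (hq : 1 ≤ q) :
    (Polynomial.Chebyshev.T ℤ q - 1).leadingCoeff = 2 ^ (q - 1) := by
  rw [Polynomial.leadingCoeff_sub_of_degree_lt, Polynomial.Chebyshev.leadingCoeff_T]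
  · simp
  · rw [Polynomial.degree_one, Polynomial.Chebyshev.degree_T]
    simp only [Int.natAbs_natCast]
    exact_mod_cast hq

open Polynomial in
/-- **(4.13)**, p. 338 [PDF 16], verbatim: *"We will now prove that 3/5 is not a solution of (4.12). Let x = M/N, where M, N are
mutually prime. Then 2^{q−1}M^q + Σ_{n=0}^{q−1} a_nM^nN^{q−n} = 0. (4.13) Therefore, N divides 2^{q−1}M^q, and so by assumption
N = 2^s for some s."* — PROVED via the rational-root theorem (Mathlib `den_dvd_of_is_root`: the reduced denominator of a
rational root divides the leading coefficient `2^{q−1}`), in the form: `x·2^{q−1} ∈ ℤ`. [cite: King1986II, (4.13) p.338] -/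
theorem mul_two_pow_int_of_root {q : ℕ} (hq : 1 ≤ q) {x : ℚ}
    (hroot : aeval x (Polynomial.Chebyshev.T ℤ q - 1) = 0) : ∃ n : ℤ, x * 2 ^ (q - 1) = n := by
  have hdvd := den_dvd_of_is_root (A := ℤ) hroot
  rw [leadingCoeff_T_sub_one hq] at hdvd
  obtain ⟨t, ht⟩ := hdvd
  have hfrac := IsFractionRing.mk'_num_den' ℤ x
  set N : ℤ := (IsFractionRing.den ℤ x : ℤ) with hN
  set Mn : ℤ := IsFractionRing.num ℤ x with hMn
  have hN0 : (N : ℚ) ≠ 0 := by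
    rw [hN]; exact_mod_cast nonZeroDivisors.coe_ne_zero _
  have hx : x = (Mn : ℚ) / N := by
    rw [← hfrac]; simp [hMn, hN]
  refine ⟨Mn * t, ?_⟩
  have h2 : (2 : ℚ) ^ (q - 1) = (N : ℚ) * t := by exact_mod_cast ht
  rw [hx, h2]
  field_simp
  push_cast
  ring

/-- *"Therefore, x = 3/5 is not a root of (4.12)"* (p. 338), arithmetic core for `4/5`: `(4/5)·2^{q−1} ∉ ℤ`, since `5 ∤ 4` and
`5 ∤ 2^{q−1}`. [cite: King1986II, (4.13) p.338] -/
theorem four_fifths_mul_two_pow_not_int (q : ℕ) (n : ℤ) : (4 / 5 : ℚ) * 2 ^ (q - 1) ≠ n := by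
  intro h
  have h1 : (4 * 2 ^ (q - 1) : ℤ) = 5 * n := by
    have : (4 * 2 ^ (q - 1) : ℚ) = 5 * n := by rw [← h]; ring
    exact_mod_cast this
  have h2 : (5 : ℤ) ∣ 4 * 2 ^ (q - 1) := ⟨n, h1⟩
  rcases (Int.Prime.dvd_mul' (by norm_num) h2) with h3 | h3
  · obtain ⟨c, hc⟩ := h3
    push_cast at hc
    omega
  · obtain ⟨c, hc⟩ := Int.Prime.dvd_pow' (by norm_num) h3
    push_cast at hc
    omega

/-- The same for the printed value `3/5`: `(3/5)·2^{q−1} ∉ ℤ` (`5 ∤ 3`, `5 ∤ 2^{q−1}` — *"by assumption N = 2^s"*, but `N = 5`).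
[cite: King1986II, (4.13) p.338] -/
theorem three_fifths_mul_two_pow_not_int (q : ℕ) (n : ℤ) : (3 / 5 : ℚ) * 2 ^ (q - 1) ≠ n := by
  intro h
  have h1 : (3 * 2 ^ (q - 1) : ℤ) = 5 * n := by
    have : (3 * 2 ^ (q - 1) : ℚ) = 5 * n := by rw [← h]; ring
    exact_mod_cast this
  have h2 : (5 : ℤ) ∣ 3 * 2 ^ (q - 1) := ⟨n, h1⟩
  rcases (Int.Prime.dvd_mul' (by norm_num) h2) with h3 | h3
  · obtain ⟨c, hc⟩ := h3
    push_cast at hc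
    omega
  · obtain ⟨c, hc⟩ := Int.Prime.dvd_pow' (by norm_num) h3
    push_cast at hc
    omega

open Polynomial in
/-- `4/5` is not a root of (4.12) `T_q − 1 = 0`, `q ≥ 1`. [cite: King1986II, (4.12)–(4.13) p.338] -/
theorem not_root_four_fifths {q : ℕ} (hq : 1 ≤ q) :
    aeval (4 / 5 : ℚ) (Polynomial.Chebyshev.T ℤ q - 1) ≠ 0 := by
  intro h
  obtain ⟨n, hn⟩ := mul_two_pow_int_of_root hq h
  exact four_fifths_mul_two_pow_not_int q n hn

open Polynomial in
/-- p. 338, verbatim: *"Therefore, x = 3/5 is not a root of (4.12)."* (`q ≥ 1`). [cite: King1986II, (4.12)–(4.13) p.338] -/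
theorem not_root_three_fifths {q : ℕ} (hq : 1 ≤ q) :
    aeval (3 / 5 : ℚ) (Polynomial.Chebyshev.T ℤ q - 1) ≠ 0 := by
  intro h
  obtain ⟨n, hn⟩ := mul_two_pow_int_of_root hq h
  exact three_fifths_mul_two_pow_not_int q n hn

open Polynomial in
/-- **(2.23) «Also, θ₀/2π is irrational.»** (Theorem 2.4, p. 327) — PROVED by King's argument pp. 337–338: a rational
`θ₀/2π = p/q` (`q ≥ 1`) makes `cos θ₀ = 4/5` a rational root of the integer polynomial `T_q − 1` with leading coefficient
`2^{q−1}` ((4.10)–(4.12)), which the rational-root theorem excludes ((4.13): the denominator `5` would divide `2^{q−1}`).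
(Mathlib's Niven theorem `niven` would give a one-line alternative; the Summits-side twin
`Summit.…ROT.irrational_arcsin_three_fifths_div_two_pi` uses it, for the spelling `arcsin (3/5) = θ₀`, `theta0_eq_arcsin`.)
[cite: King1986II, Thm 2.4 (2.23) p.327, (4.10)–(4.13) pp.337–338] -/
theorem irrational_theta0_div_two_pi : Irrational (theta0 / (2 * π)) := by
  rintro ⟨r, hr⟩
  have hq : 1 ≤ r.den := r.pos
  have hπ : (2 * π : ℝ) ≠ 0 := by positivity
  have hθr : theta0 = (r : ℝ) * (2 * π) := by
    rw [hr]; field_simp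
  have hθ : theta0 * (r.den : ℕ) = (r.num : ℤ) * (2 * π) := by
    rw [hθr]
    have hden : (r.den : ℝ) ≠ 0 := by exact_mod_cast r.den_nz
    have : (r : ℝ) = (r.num : ℝ) / (r.den : ℝ) := by exact_mod_cast (Rat.num_div_den r).symm
    rw [this]
    field_simp
  have h1 : (Polynomial.Chebyshev.T ℝ r.den).eval (Real.cos theta0) = 1 := chebyshev_eval_cos_eq_one hθ
  have h2 : aeval ((4 / 5 : ℚ)) (Polynomial.Chebyshev.T ℤ r.den - 1) = 0 := by
    have h3 : algebraMap ℚ ℝ (aeval (4 / 5 : ℚ) (Polynomial.Chebyshev.T ℤ r.den - 1)) = 0 := by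
      rw [← Polynomial.aeval_algebraMap_apply]
      have h45 : algebraMap ℚ ℝ (4 / 5 : ℚ) = Real.cos theta0 := by rw [cos_theta0]; push_cast; norm_num
      rw [h45, map_sub, Polynomial.Chebyshev.aeval_T, h1]
      simp
    exact (map_eq_zero_iff (algebraMap ℚ ℝ) (algebraMap ℚ ℝ).injective).1 h3
  exact not_root_four_fifths hq h2

/-- p. 328: the rotations by multiples of `θ₀` are dense in the rotation group of the `μν`-plane — `ℤθ₀ + 2πℤ` is dense in `ℝ`
(`dense_closure_theta0_two_pi` with (2.23) discharged). [cite: King1986II, p.328, (2.23) p.327] -/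
theorem dense_closure_theta0_two_pi' :
    Dense ((AddSubgroup.closure ({theta0, 2 * π} : Set ℝ) : AddSubgroup ℝ) : Set ℝ) :=
  dense_closure_theta0_two_pi irrational_theta0_div_two_pi

/-! ## §3 (4.3)–(4.4): the modified (rotated-block) averaging operators, as instances of `Balaban1983to89.B1.blockAvg` -/

section Averaging

open Literature.MathematicalPhysics.QuantumFieldTheory.Balaban1983to89

/-- **(4.3)** p. 336 [PDF 14], verbatim: *"In order to compare these models we consider a modified block spin transformation.
Each lattice site y in T_{R(5ε)} defines a block of 5^d sites on T_ε, which we denote by B̂(y). We introduce corresponding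
averaging operators (Q̂A_μ)(y) = 5^{−d} Σ_{x∈B̂(y)} A_μ(x), (4.3)"*.  TYPED as the tree's weighted block sum `B1.blockAvg`
([Ba 1] (2.7)/(2.11)) with weight `5^{−d}`, trivial holonomy, block assignment `blk : T → Finset S` (`S` ↤ sites of `T_ε`,
`T` ↤ sites of `T_{R(5ε)}`, `blk y` ↤ `B̂(y)`), applied to one component `A_μ : S → ℝ`. [cite: King1986II, (4.3) p.336] -/
def qhatVec {S T : Type} (d : ℕ) (blk : T → Finset S) (A : S → ℝ) : T → ℝ :=
  B1.blockAvg (((5 : ℝ) ^ d)⁻¹) blk (fun _ _ => LinearMap.id) A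

/-- **(4.4)** p. 336 [PDF 14], verbatim: *"(Q̂(A)φ)(y) = 5^{−d} Σ_{x∈B̂(y)} U(A(Γ̂_{y,x}))φ(x), (4.4) where the contour Γ̂_{y,x} is
chosen to lie entirely inside B̂(y)."*  TYPED as `B1.blockAvg` with weight `5^{−d}` and holonomy `hol y x` ↤ the `U(1)` phase
`U(A(Γ̂_{y,x}))` acting `ℝ`-linearly on `φ(x) ∈ ℂ`. [cite: King1986II, (4.4) p.336] -/
def qhatScalar {S T : Type} (d : ℕ) (blk : T → Finset S) (hol : T → S → ℂ →ₗ[ℝ] ℂ) (φ : S → ℂ) : T → ℂ :=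
  B1.blockAvg (((5 : ℝ) ^ d)⁻¹) blk hol φ

/-- Unfolding of (4.3): `(Q̂A_μ)(y) = 5^{−d} Σ_{x∈B̂(y)} A_μ(x)`. [cite: King1986II, (4.3) p.336] -/
theorem qhatVec_apply {S T : Type} (d : ℕ) (blk : T → Finset S) (A : S → ℝ) (y : T) :
    qhatVec d blk A y = ((5 : ℝ) ^ d)⁻¹ * ∑ x ∈ blk y, A x := by
  simp [qhatVec, B1.blockAvg, smul_eq_mul]

/-- Unfolding of (4.4). [cite: King1986II, (4.4) p.336] -/
theorem qhatScalar_apply {S T : Type} (d : ℕ) (blk : T → Finset S) (hol : T → S → ℂ →ₗ[ℝ] ℂ) (φ : S → ℂ) (y : T) :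
    qhatScalar d blk hol φ y = (((5 : ℝ) ^ d)⁻¹ : ℝ) • ∑ x ∈ blk y, hol y x (φ x) := rfl

/-- `Q̂` of a constant vector field is the constant, when every block `B̂(y)` has `5^d` sites (p. 336). [cite: King1986II, (4.3) p.336] -/
theorem qhatVec_const {S T : Type} (d : ℕ) {blk : T → Finset S} (hcard : ∀ y, (blk y).card = 5 ^ d) (c : ℝ) :
    qhatVec d blk (fun _ => c) = fun _ => c := by
  funext y
  rw [qhatVec_apply, Finset.sum_const, hcard, nsmul_eq_mul]
  push_cast
  have : (5 : ℝ) ^ d ≠ 0 := pow_ne_zero _ (by norm_num)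
  field_simp

end Averaging

/-! ## §4 THEOREM 2.4 (2.22)–(2.23) AS PRINTED (hypothesis schema over the two expectation families (2.20), (2.21)) -/

/-- **The data of Theorem 2.4** (pp. 325–327): the torus `D_J` (4.1) (`M` of (2.7), `J`), and the two families of periodic-b.c.
expectations of the observables **(2.14)** *"O(zg, wh) = exp[zF(g) + w:φ²:(h)], where g, h ∈ C₀^∞(ℝ^d) and z, w ∈ ℂ"* —
**(2.20)** *"⟨O⟩_p^{ε_K, D_J}"* (axis lattices of spacing `ε_K = 5^{−K}` fitting `D_J`) and **(2.21)** *"⟨O⟩_p^{R(ε_K), D_J}"* (the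
lattices rotated by `θ₀`): `Est g h z w K`, `Erot g h z w K ∈ ℂ`.  ABSTRACT: the lattice U(1) Higgs measures (2.5)–(2.10) and
the operators `F(g)` (2.12), `:φ²:(h)` (2.13) are not constructed here. [cite: King1986II, (2.14) p.325, (2.20)–(2.21) p.327] -/
structure Thm24Data (d : ℕ) where
  /-- the large integer `M` of (2.7)/(4.1) -/
  M : ℕ
  /-- the size parameter `J` of `D_J` -/
  J : ℕ
  M_pos : 0 < M
  J_pos : 0 < J
  /-- `⟨O(zg, wh)⟩_p^{ε_K, D_J}` (2.20) -/
  Est : ((Fin d → ℝ) → ℝ) → ((Fin d → ℝ) → ℝ) → ℂ → ℂ → ℕ → ℂ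
  /-- `⟨O(zg, wh)⟩_p^{R(ε_K), D_J}` (2.21) -/
  Erot : ((Fin d → ℝ) → ℝ) → ((Fin d → ℝ) → ℝ) → ℂ → ℂ → ℕ → ℂ

namespace Thm24Data

variable {d : ℕ} (T : Thm24Data d)

/-- The box `D_J` (4.1) of the data. [cite: King1986II, (4.1) p.336] -/
def box : Set (Fin d → ℝ) := boxD d T.M T.J

/-- The torus `D_J` of the data as a [K I] (2.21)-torus. [cite: King1986II, (4.1) p.336; King1986, (2.21) p.654] -/
def torus : Torus221 d := torusD d T.M_pos T.J_pos

/-- The torus of the data has the box `D_J` as carrier. [cite: King1986II, (4.1) p.336] -/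
theorem torus_carrier : T.torus.carrier = T.box := torusD_carrier d T.M_pos T.J_pos

/-- *"For g, h supported in D_J"* (Theorem 2.4) with *"g, h ∈ C₀^∞(ℝ^d)"* ((2.14)): smooth, support inside the box `D_J`.
[cite: King1986II, (2.14) p.325, Thm 2.4 p.327] -/
def Admissible (f : (Fin d → ℝ) → ℝ) : Prop := ContDiff ℝ (⊤ : ℕ∞) f ∧ Function.support f ⊆ T.box

/-- **(2.22)**, p. 327 [PDF 5], verbatim: *"We can now state our result concerning rotation invariance. **Theorem 2.4.** For g, h
supported in D_J, and z, w ∈ ℂ, lim_{K→∞} ⟨O(zg, wh)⟩_p^{ε_K, D_J} = lim_{K→∞} ⟨O(zg, wh)⟩_p^{R(ε_K), D_J}. (2.22)"* — read as: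
both limits exist and are equal (existence of each: [K I] Theorem 2.1 on the torus `D_J`, which p. 336 says applies to both
models).  HYPOTHESIS SCHEMA. [cite: King1986II, Thm 2.4 (2.22) p.327] -/
def Eq222 : Prop :=
  ∀ g h, T.Admissible g → T.Admissible h → ∀ z w : ℂ,
    ∃ ℓ : ℂ, Tendsto (T.Est g h z w) atTop (𝓝 ℓ) ∧ Tendsto (T.Erot g h z w) atTop (𝓝 ℓ)

end Thm24Data

/-- **THEOREM 2.4 AS PRINTED** = (2.22) ∧ **(2.23)** *"Also, θ₀/2π is irrational. (2.23)"*.  The second conjunct is the theorem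
`irrational_theta0_div_two_pi`; the first is the schema `Eq222`. [cite: King1986II, Thm 2.4 (2.22)–(2.23) p.327] -/
def Thm24Printed {d : ℕ} (T : Thm24Data d) : Prop := T.Eq222 ∧ Irrational (theta0 / (2 * π))

/-- Theorem 2.4 reduces to (2.22), (2.23) being proved. [cite: King1986II, Thm 2.4 (2.22)–(2.23) p.327] -/
theorem thm24Printed_iff {d : ℕ} (T : Thm24Data d) : Thm24Printed T ↔ T.Eq222 :=
  ⟨fun h => h.1, fun h => ⟨h, irrational_theta0_div_two_pi⟩⟩

/-! ## §5 §4 pp. 336–337 AS SCHEMA: (4.2), Proposition 4.1 (4.5), Theorem 4.2 (4.6), the mirror analogues — and the deduction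
(4.7)–(4.9) «Theorem 2.4 follows» PROVED over the schema -/

/-! ### The one-sided device (4.7)–(4.9), PROVED for an arbitrary measure space -/

section Device

variable {W : Type*} [MeasurableSpace W]

/-- **(4.7)–(4.9), the mechanism, PROVED** for an arbitrary measure space.  p. 337 [PDF 15], verbatim: *"First, using the results
of [Ba 2] (as stated in Theorem 3.1 of [K 1]) and Proposition 4.1, Z^{R(5ε)}(D_J, g, h) − Z^ε(D_J, g, h) ≤ ∫(dA_k)(dφ_k)χ_k(A_k)
χ_k(φ_k)·{exp[−S^{(k−1),1}(T^{(k)}, A_k, φ_k, g, h)] − exp[−Ŝ^{(k),1}(T^{(k)}, A_k, φ_k, g, h)]}·e^{C(L^kε)^σ|D_J|} +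
e^{−p(L^kε)² + C|D_J|}. (4.7) We now use Theorem 4.2 and the bound e^x − e^y ≤ |e^x − e^y| ≤ |x − y|(e^x + e^y), (4.8) which
gives (4.7) ≤ C(L^{−γk}(L^kε)^{−β} + (L^kε)^σ)|D_J|{Z^{R(5ε)}(D_J, g, h) + Z^ε(D_J, g, h)}·… (4.9)"*.  Abstractly: if
`Z′ ≤ I′ + E` and `I′ ≤ Z′` (Theorem 3.1 (3.3)–(3.4) for `Z′ = Z^{R(5ε)}`, `I′ = ∫χe^{−S′+c′}`), `I ≤ Z` (Proposition 4.1 for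
`Z = Z^ε`, `I = ∫χe^{−Ŝ+c}`), `χ ∈ {0, 1}` and `χ|Ŝ − S′| ≤ δ` (Theorem 4.2), then `Z′ − Z ≤ (δ + |c − c′|)(Z + Z′) + E` —
the two correction constants `c = C(L^kε)^σ|D_J|` of (4.5) and `c′` of (3.3)–(3.4) are kept distinct (King's generic `C`).
[cite: King1986II, (4.7)–(4.9) p.337] -/
theorem sub_le_of_oneSided_bounds (μ : Measure W) {χ S S' : W → ℝ} {Z Z' c c' E δ : ℝ}
    (hχ : ∀ x, χ x = 0 ∨ χ x = 1)
    (hI : Integrable (fun x => χ x * Real.exp (-(S x) + c)) μ)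
    (hI' : Integrable (fun x => χ x * Real.exp (-(S' x) + c')) μ)
    (h45 : ∫ x, χ x * Real.exp (-(S x) + c) ∂μ ≤ Z)
    (h33' : ∫ x, χ x * Real.exp (-(S' x) + c') ∂μ ≤ Z')
    (h34' : Z' ≤ (∫ x, χ x * Real.exp (-(S' x) + c') ∂μ) + E)
    (h46 : ∀ x, χ x * |S x - S' x| ≤ δ) (hδ : 0 ≤ δ) :
    Z' - Z ≤ (δ + |c - c'|) * (Z + Z') + E := by
  set f : W → ℝ := fun x => χ x * Real.exp (-(S x) + c) with hf
  set g : W → ℝ := fun x => χ x * Real.exp (-(S' x) + c') with hg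
  -- (4.7): Z' − Z ≤ (I' − I) + E ≤ |I − I'| + E
  have h47 : Z' - Z ≤ |(∫ x, f x ∂μ) - ∫ x, g x ∂μ| + E := by
    have := neg_abs_le ((∫ x, f x ∂μ) - ∫ x, g x ∂μ)
    linarith
  -- pointwise (4.8): |f − g| ≤ (δ + |c − c'|)(f + g)
  have hpt : ∀ x, |f x - g x| ≤ (δ + |c - c'|) * (f x + g x) := by
    intro x
    rcases hχ x with h0 | h1
    · simp [hf, hg, h0]
    · have hx := h46 x
      rw [h1, one_mul] at hx
      simp only [hf, hg, h1, one_mul]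
      have hexp := abs_exp_sub_exp_le (-(S x) + c) (-(S' x) + c')
      have hsub : |(-(S x) + c) - (-(S' x) + c')| ≤ |S x - S' x| + |c - c'| := by
        rw [show (-(S x) + c) - (-(S' x) + c') = -(S x - S' x) + (c - c') by ring]
        calc |-(S x - S' x) + (c - c')| ≤ |-(S x - S' x)| + |c - c'| := abs_add_le _ _
          _ = |S x - S' x| + |c - c'| := by rw [abs_neg]
      have hpos : 0 ≤ Real.exp (-(S x) + c) + Real.exp (-(S' x) + c') := by positivity
      calc |Real.exp (-(S x) + c) - Real.exp (-(S' x) + c')|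
          ≤ |(-(S x) + c) - (-(S' x) + c')| * (Real.exp (-(S x) + c) + Real.exp (-(S' x) + c')) := hexp
        _ ≤ (|S x - S' x| + |c - c'|) * (Real.exp (-(S x) + c) + Real.exp (-(S' x) + c')) :=
            mul_le_mul_of_nonneg_right hsub hpos
        _ ≤ (δ + |c - c'|) * (Real.exp (-(S x) + c) + Real.exp (-(S' x) + c')) :=
            mul_le_mul_of_nonneg_right (by linarith) hpos
  -- (4.9), first line: |I − I'| ≤ (δ + |c − c'|)(I + I') ≤ (δ + |c − c'|)(Z + Z')
  have hδ' : 0 ≤ δ + |c - c'| := by positivity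
  have hint : |(∫ x, f x ∂μ) - ∫ x, g x ∂μ| ≤ (δ + |c - c'|) * ((∫ x, f x ∂μ) + ∫ x, g x ∂μ) := by
    rw [← integral_sub hI hI']
    calc |∫ x, (f x - g x) ∂μ| ≤ ∫ x, |f x - g x| ∂μ := abs_integral_le_integral_abs
      _ ≤ ∫ x, (δ + |c - c'|) * (f x + g x) ∂μ :=
          integral_mono (hI.sub hI').abs ((hI.add hI').const_mul _) hpt
      _ = (δ + |c - c'|) * ((∫ x, f x ∂μ) + ∫ x, g x ∂μ) := by
          rw [integral_const_mul, integral_add hI hI']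
  have hZZ : (δ + |c - c'|) * ((∫ x, f x ∂μ) + ∫ x, g x ∂μ) ≤ (δ + |c - c'|) * (Z + Z') :=
    mul_le_mul_of_nonneg_left (by linarith) hδ'
  linarith

end Device

/-- Monotonicity of the geometric rates in the exponent: `L^{−eK} ≤ L^{−aK}` for `a ≤ e`, `L ≥ 1`. [cite: King1986, (3.13) p.657] -/
theorem rpow_neg_mul_le {L : ℝ} (hL : 1 ≤ L) {a e : ℝ} (hae : a ≤ e) (K : ℕ) :
    L ^ (-(e * K)) ≤ L ^ (-(a * K)) :=
  Real.rpow_le_rpow_of_exponent_le hL (by have : (0 : ℝ) ≤ K := K.cast_nonneg; nlinarith)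

/-- The choice (3.12) of [K I] gives `k ≥ 1` once `K ≥ (2β+γ)/(2β)` (needed here because the rotated model is compared after
`k − 1` steps, Theorem 4.2). [cite: King1986, (3.12) p.657; King1986II, Thm 4.2 p.337] -/
theorem one_le_kChoice {β γ : ℝ} (hβ : 0 < β) (hγ : 0 < γ) {K : ℕ} (hK : (2 * β + γ) / (2 * β) ≤ K) :
    1 ≤ kChoice β γ K := by
  unfold kChoice
  have hden : 0 < 2 * β + γ := by linarith
  have h1 : (1 : ℝ) ≤ 2 * β * K / (2 * β + γ) := by
    rw [le_div_iff₀ hden]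
    rw [div_le_iff₀ (by positivity)] at hK
    linarith
  exact Nat.one_le_floor_iff _ |>.2 (by exact_mod_cast h1) |> fun h => h

namespace Core

variable {W : ℕ → Type*} [∀ m, MeasurableSpace (W m)]

/-- **pp. 336–337, ONE DIRECTION OF THE PROOF OF THEOREM 2.4, PROVED over the schema — quantitative form.**  Ingredients, in
the `(m, k)` indexing of [K I]'s `RGData` (`m = K − k` remaining scales, `L^kε_K = ε_m`): a two-sided family `B` ([K I]
Theorem 3.1 (3.3)–(3.4) `B.Thm31Printed`: *"using the results of [Ba 2] (as stated in Theorem 3.1 of [K 1])"*), a hat family of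
effective actions `Shat` with partition functions `A` and a Proposition-4.1-type lower bound (`h41`, (4.5)), a Theorem-4.2-type
comparison `χ|Shat^{(j+s)} − S_B^{(j+t)}| ≤ C(L^{−γ(j+1)}(L^kε)^{−β} + (L^kε)^σ)|D_J|` (`h42`, (4.6); `(s, t) = (1, 0)` is (4.6)
itself, `(0, 1)` its mirror), upper ultra-violet stability bounds (4.2) for both, `χ ∈ {0, 1}`, finiteness, `L > 1`, `b₀ > 0`,
`p ≥ 1`.  CONCLUSION ((4.7)–(4.9) at `k = [2βK(2β+γ)⁻¹]`, [K I] (3.12)–(3.13)): there are `a > 0`, `Bc ≥ 0`, `n₀` with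
`B.Z(n + t) − A(n + s) ≤ Bc·L^{−a(n+1)}` for all `n ≥ n₀`; explicitly `a = γ·min(β, σ, σ₁, σ₄, b₀²)/(2β+γ)` where `σ₁`, `σ₄`
are the correction exponents of (3.3)–(3.4) and (4.5), and the large-field remainder enters through *"exp[−p(ε)²] ≤ ε^σ"*
([K I] p. 657, `exp_neg_pFn_sq_le`). [cite: King1986II, (4.7)–(4.9) p.337; King1986, (3.12)–(3.13) p.657] -/
theorem oneSided (B : RGData W) (Shat : ∀ m, ℕ → W m → ℝ) (A : ℕ → ℝ) (s t : ℕ)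
    (hL : 1 < B.L) (hb : 0 < B.b₀) (hp : 1 ≤ B.p) (hvol : 0 ≤ B.vol)
    (hχ : ∀ m w, B.chi m w = 0 ∨ B.chi m w = 1)
    (hfinB : ∀ (C σ : ℝ) (m k : ℕ),
      Integrable (fun w => B.chi m w * Real.exp (-(B.S m k w) + C * (eps B.L m) ^ σ * B.vol)) (B.μ m))
    (hfinH : ∀ (C σ : ℝ) (m k : ℕ),
      Integrable (fun w => B.chi m w * Real.exp (-(Shat m k w) + C * (eps B.L m) ^ σ * B.vol)) (B.μ m))
    (h31 : B.Thm31Printed)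
    (h41 : ∃ σ C : ℝ, 0 < σ ∧ ∀ m k : ℕ,
      ∫ w, B.chi m w * Real.exp (-(Shat m k w) + C * (eps B.L m) ^ σ * B.vol) ∂(B.μ m) ≤ A (m + k))
    (h42 : ∃ γ σ β C : ℝ, 0 < γ ∧ γ < 1 ∧ 0 < σ ∧ 0 < β ∧ ∀ (m j : ℕ) (w : W m),
      B.chi m w * |Shat m (j + s) w - B.S m (j + t) w|
        ≤ C * ((B.L : ℝ) ^ (-(γ * ((j + 1 : ℕ) : ℝ))) * (eps B.L m) ^ (-β) + (eps B.L m) ^ σ) * B.vol)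
    (hA : ∃ C₂ : ℝ, ∀ K, A K ≤ Real.exp (C₂ * B.vol)) (hB : ∃ C₂ : ℝ, ∀ K, B.Z K ≤ Real.exp (C₂ * B.vol)) :
    ∃ (a Bc : ℝ) (n₀ : ℕ), 0 < a ∧ 0 ≤ Bc ∧ ∀ n : ℕ, n₀ ≤ n →
      B.Z (n + t) - A (n + s) ≤ Bc * (B.L : ℝ) ^ (-(a * ((n + 1 : ℕ) : ℝ))) := by
  obtain ⟨J, σ₁, C₁, hσ₁, h31⟩ := h31
  obtain ⟨σ₄, C₄, hσ₄, h41⟩ := h41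
  obtain ⟨γ, σ, β, C, hγ, _hγ1, hσ, hβ, h42⟩ := h42
  obtain ⟨C₂, hA⟩ := hA
  obtain ⟨C₃, hB⟩ := hB
  have hL0 : 0 < B.L := by omega
  have hL1 : 1 ≤ B.L := hL.le
  have hLr : (1 : ℝ) < B.L := by exact_mod_cast hL
  have hLr0 : (0 : ℝ) < B.L := by linarith
  have hLr1 : (1 : ℝ) ≤ B.L := hLr.le
  have hden : 0 < 2 * β + γ := by linarith
  -- the common exponent
  set s₀ : ℝ := min (min (min β σ) (min σ₁ σ₄)) (B.b₀ ^ 2) with hs₀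
  have hs₀pos : 0 < s₀ := by
    simp only [hs₀, lt_min_iff]; exact ⟨⟨⟨hβ, hσ⟩, ⟨hσ₁, hσ₄⟩⟩, by positivity⟩
  have hs₀β : s₀ ≤ β := le_trans (min_le_left _ _) (le_trans (min_le_left _ _) (min_le_left _ _))
  have hs₀σ : s₀ ≤ σ := le_trans (min_le_left _ _) (le_trans (min_le_left _ _) (min_le_right _ _))
  have hs₀σ₁ : s₀ ≤ σ₁ := le_trans (min_le_left _ _) (le_trans (min_le_right _ _) (min_le_left _ _))
  have hs₀σ₄ : s₀ ≤ σ₄ := le_trans (min_le_left _ _) (le_trans (min_le_right _ _) (min_le_right _ _))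
  have hs₀b : s₀ ≤ B.b₀ ^ 2 := min_le_right _ _
  set a : ℝ := s₀ * γ / (2 * β + γ) with ha
  have hapos : 0 < a := by rw [ha]; positivity
  have hale : ∀ x : ℝ, s₀ ≤ x → a ≤ x * γ / (2 * β + γ) := by
    intro x hx
    rw [ha]
    exact div_le_div_of_nonneg_right (mul_le_mul_of_nonneg_right hx hγ.le) hden.le
  -- the total volume factor and the constant
  set V : ℝ := Real.exp (C₂ * B.vol) + Real.exp (C₃ * B.vol) with hV
  have hVpos : 0 < V := by positivity
  set Bc : ℝ := (2 * |C| * B.vol * (B.L : ℝ) ^ (β + γ) + |C₄| * B.vol + |C₁| * B.vol) * V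
    + Real.exp (C₁ * B.vol) with hBc
  -- the threshold
  set n₀ : ℕ := max ⌈(2 * β + γ) / (2 * β)⌉₊ ⌈(J : ℝ) * (2 * β + γ) / γ⌉₊ with hn₀
  refine ⟨a, Bc, n₀, hapos, by positivity, ?_⟩
  intro n hn
  -- K = n + 1 (the spacing index of the finer model), k = [2βK/(2β+γ)], m = K − k, j = k − 1
  set K : ℕ := n + 1 with hK
  have hKn₀ : (n₀ : ℝ) ≤ K := by
    have : n₀ ≤ K := by omega
    exact_mod_cast this
  set k : ℕ := kChoice β γ K with hk
  have hkK : k ≤ K := kChoice_le hβ hγ K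
  have hk1 : 1 ≤ k := by
    refine one_le_kChoice hβ hγ (le_trans (Nat.le_ceil _) (le_trans ?_ hKn₀))
    exact_mod_cast le_max_left _ _
  set m : ℕ := K - k with hm
  have hmK : m + k = K := Nat.sub_add_cancel hkK
  have hmr : (m : ℝ) = (K : ℝ) - k := by rw [hm]; exact Nat.cast_sub hkK
  have hmJ : J ≤ m := by
    have h1 : γ / (2 * β + γ) * K ≤ (m : ℝ) := by rw [hmr]; exact sub_kChoice_ge hβ hγ K
    have h2 : (J : ℝ) * (2 * β + γ) / γ ≤ K :=
      le_trans (Nat.le_ceil _) (le_trans (by exact_mod_cast le_max_right _ _) hKn₀)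
    have h3 : (J : ℝ) ≤ γ / (2 * β + γ) * K := by
      rw [div_le_iff₀ hγ] at h2
      rw [div_mul_eq_mul_div, le_div_iff₀ hden]
      linarith
    exact_mod_cast h3.trans h1
  set j : ℕ := k - 1 with hj
  have hjk : j + 1 = k := by omega
  have hn_eq : n = m + j := by omega
  -- Theorem 3.1 for `B.Z (n + t)` after `j + t` steps; Proposition 4.1 for `A (n + s)` after `j + s` steps
  obtain ⟨h33', h34'⟩ := h31 m (j + t) hmJ
  have h45 := h41 m (j + s)
  rw [show m + (j + t) = n + t by omega] at h33' h34'
  rw [show m + (j + s) = n + s by omega] at h45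
  -- Theorem 4.2 as `χ|Ŝ − S| ≤ δ = |C|·rate·|D_J|`
  set rate : ℝ := (B.L : ℝ) ^ (-(γ * k)) * (eps B.L m) ^ (-β) + (eps B.L m) ^ σ with hrate
  have heps0 : 0 < eps B.L m := eps_pos hL0 m
  have hrate0 : 0 ≤ rate := by positivity
  have h46 : ∀ w : W m, B.chi m w * |Shat m (j + s) w - B.S m (j + t) w| ≤ |C| * rate * B.vol := by
    intro w
    refine (h42 m j w).trans ?_
    rw [hjk]
    have h2 : 0 ≤ rate * B.vol := by positivity
    have := le_abs_self C
    simp only [← hrate]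
    nlinarith
  -- the device (4.7)–(4.9)
  have hmain := sub_le_of_oneSided_bounds (B.μ m) (hχ m) (hfinH C₄ σ₄ m (j + s)) (hfinB C₁ σ₁ m (j + t))
    h45 h33' h34' h46 (by positivity)
  -- (4.2): `Z^{R(5ε)} + Z^ε ≤ V`
  have hZsum : A (n + s) + B.Z (n + t) ≤ V := by
    have := hA (n + s); have := hB (n + t); simp only [hV]; linarith
  have hcoef0 : 0 ≤ |C| * rate * B.vol
      + |C₄ * (eps B.L m) ^ σ₄ * B.vol - C₁ * (eps B.L m) ^ σ₁ * B.vol| := by positivity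
  have hstep1 : B.Z (n + t) - A (n + s)
      ≤ (|C| * rate * B.vol + |C₄ * (eps B.L m) ^ σ₄ * B.vol - C₁ * (eps B.L m) ^ σ₁ * B.vol|) * V
        + B.largeFieldRemainder C₁ m := by
    have := mul_le_mul_of_nonneg_left hZsum hcoef0
    unfold RGData.largeFieldRemainder
    unfold RGData.largeFieldRemainder at hmain
    linarith
  -- |c − c'| ≤ |C₄| ε^σ₄ |D_J| + |C₁| ε^σ₁ |D_J|
  have hcc : |C₄ * (eps B.L m) ^ σ₄ * B.vol - C₁ * (eps B.L m) ^ σ₁ * B.vol|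
      ≤ |C₄| * (eps B.L m) ^ σ₄ * B.vol + |C₁| * (eps B.L m) ^ σ₁ * B.vol := by
    refine (abs_sub _ _).trans ?_
    rw [abs_mul, abs_mul, abs_mul, abs_mul, abs_of_pos (Real.rpow_pos_of_pos heps0 _),
      abs_of_pos (Real.rpow_pos_of_pos heps0 _), abs_of_nonneg hvol]
  -- [K I] (3.13): the rate at the chosen k
  have hrate313 : rate ≤ (B.L : ℝ) ^ (β + γ) * ((B.L : ℝ) ^ (-(β * γ / (2 * β + γ) * K))
      + (B.L : ℝ) ^ (-(σ * γ / (2 * β + γ) * K))) := by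
    have h1 : (eps B.L m) ^ (-β) = (B.L : ℝ) ^ (β * ((K : ℝ) - k)) := by
      rw [eps_rpow hL0, hmr]; ring_nf
    have h2 : (eps B.L m) ^ σ = (B.L : ℝ) ^ (-(σ * ((K : ℝ) - k))) := by
      rw [eps_rpow hL0, hmr]
    rw [hrate, h1, h2]
    exact rate_at_kChoice hLr hβ hγ hσ K
  have hepsle : ∀ x : ℝ, 0 < x → s₀ ≤ x → (eps B.L m) ^ x ≤ (B.L : ℝ) ^ (-(a * K)) := by
    intro x hx hsx
    rw [eps_rpow hL0, hmr]
    have h := (exponents_at_kChoice (σ := x) hβ hγ hx K).2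
    refine (Real.rpow_le_rpow_of_exponent_le hLr1 h).trans ?_
    exact rpow_neg_mul_le hLr1 (hale x hsx) K
  have hgeo1 : (B.L : ℝ) ^ (-(β * γ / (2 * β + γ) * K)) ≤ (B.L : ℝ) ^ (-(a * K)) :=
    rpow_neg_mul_le hLr1 (hale β hs₀β) K
  have hgeo2 : (B.L : ℝ) ^ (-(σ * γ / (2 * β + γ) * K)) ≤ (B.L : ℝ) ^ (-(a * K)) :=
    rpow_neg_mul_le hLr1 (hale σ hs₀σ) K
  have hgeo4 := hepsle σ₄ hσ₄ hs₀σ₄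
  have hgeo3 := hepsle σ₁ hσ₁ hs₀σ₁
  have hgeo5 := hepsle (B.b₀ ^ 2) (by positivity) hs₀b
  set G : ℝ := (B.L : ℝ) ^ (-(a * K)) with hG
  have hG0 : 0 ≤ G := Real.rpow_nonneg hLr0.le _
  -- the large-field remainder: exp[−p(L^kε)² + C₁|D_J|] ≤ e^{C₁|D_J|}·(L^kε)^{b₀²} ≤ e^{C₁|D_J|}·G
  have hE : B.largeFieldRemainder C₁ m ≤ Real.exp (C₁ * B.vol) * G := by
    unfold RGData.largeFieldRemainder
    rw [Real.exp_add, mul_comm]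
    refine mul_le_mul_of_nonneg_left ?_ (Real.exp_pos _).le
    exact (exp_neg_pFn_sq_le hb hp heps0 (eps_le_one hL1 m)).trans hgeo5
  -- assemble
  have hrateG : rate ≤ (B.L : ℝ) ^ (β + γ) * (2 * G) := by
    refine hrate313.trans ?_
    refine mul_le_mul_of_nonneg_left ?_ (Real.rpow_nonneg hLr0.le _)
    linarith
  have hcoef : |C| * rate * B.vol + |C₄ * (eps B.L m) ^ σ₄ * B.vol - C₁ * (eps B.L m) ^ σ₁ * B.vol|
      ≤ (2 * |C| * B.vol * (B.L : ℝ) ^ (β + γ) + |C₄| * B.vol + |C₁| * B.vol) * G := by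
    have h1 : |C| * rate * B.vol ≤ |C| * ((B.L : ℝ) ^ (β + γ) * (2 * G)) * B.vol :=
      mul_le_mul_of_nonneg_right (mul_le_mul_of_nonneg_left hrateG (abs_nonneg C)) hvol
    have h4 : |C₄| * (eps B.L m) ^ σ₄ * B.vol ≤ |C₄| * G * B.vol :=
      mul_le_mul_of_nonneg_right (mul_le_mul_of_nonneg_left hgeo4 (abs_nonneg _)) hvol
    have h3 : |C₁| * (eps B.L m) ^ σ₁ * B.vol ≤ |C₁| * G * B.vol :=
      mul_le_mul_of_nonneg_right (mul_le_mul_of_nonneg_left hgeo3 (abs_nonneg _)) hvol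
    have hring : |C| * ((B.L : ℝ) ^ (β + γ) * (2 * G)) * B.vol + |C₄| * G * B.vol + |C₁| * G * B.vol
        = (2 * |C| * B.vol * (B.L : ℝ) ^ (β + γ) + |C₄| * B.vol + |C₁| * B.vol) * G := by ring
    linarith [hcc]
  have hfinal : (|C| * rate * B.vol + |C₄ * (eps B.L m) ^ σ₄ * B.vol - C₁ * (eps B.L m) ^ σ₁ * B.vol|) * V
      + B.largeFieldRemainder C₁ m ≤ Bc * G := by
    have h1 := mul_le_mul_of_nonneg_right hcoef hVpos.le
    have hring : (2 * |C| * B.vol * (B.L : ℝ) ^ (β + γ) + |C₄| * B.vol + |C₁| * B.vol) * G * V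
        + Real.exp (C₁ * B.vol) * G = Bc * G := by rw [hBc]; ring
    linarith [hE]
  exact hstep1.trans hfinal

end Core

/-! ### The objects of §4 as a schema -/

/-- **The data of §4**, pp. 336–337 [PDF 14–15], verbatim: *"We denote by Z^ε(D_J, g, h) the generating functional on the lattice
T_ε with spacing ε and the "usual" orientation. We will denote by Z^{R(ε)}(D_J, g, h) the generating functional on the lattice
T_{R(ε)} with spacing ε, but rotated by an angle θ₀ as shown in Fig. 1. … Using the operators (4.3), (4.4) we can generate from
Z^ε(D_J, g, h) an effective action on the lattice T^{(1)}_{R(5ε)}, which we write Ŝ^{(1),R(5ε)}(T^{(1)}, A₁, φ₁, g, h). By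
applying succeeding steps of the renormalization transformation in the usual way, that is without rotating the blocks, we
generate effective actions Ŝ^{(k),R(5^kε)}(T^{(k)}, A_k, φ_k, g, h) on the lattices T^{(k)}_{R(5^kε)}. … We can also perform the
usual renormalization transformations on Z^{R(5ε)}(D_J, g, h). This produces effective actions S^{(k−1),R(5^kε)}(T^{(k)}, A_k,
φ_k, g, h) on the lattices T^{(k)}_{R(5^kε)}, which we can compare with the previous actions."*; and for the switched argument
(p. 337): *"rotated blocks are used to generate from Z^{R(5ε)}(D_J, g, h) an effective action on the lattice T^{(1)}_{5²ε}, and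
other actions on T^{(k−1)}_{5^kε}. These are compared with the actions generated from Z^ε(D_J, g, h) by the usual
transformations."*  INDEXING as in [K I]'s `RGData` (`L = 5`, `ε = ε_K`, `m := K − k` remaining scales, so every action below
lives at physical spacing `5^kε_K = ε_m`): `X m` ↤ unit-lattice configurations `(A_k, φ_k)` on the ROTATED lattices
`T^{(k)}_{R(5^kε)}`, `Y m` ↤ on the axis lattices `T^{(k)}_{5^kε}`; `μX, μY` ↤ `(dA)(dφ)`; `chiX, chiY` ↤ `χ_k(A_k)χ_k(φ_k)`;
`Sst m k` ↤ `S^{(k),st}` (`k` usual steps from `Z^{ε_{m+k}}`), `SstHat m k` ↤ `Ŝ^{(k),R(5^kε)}` (from `Z^{ε_{m+k}}`, first block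
rotated), `Srot m j` ↤ `S^{(j),R}` (`j` usual steps from `Z^{R(ε_{m+j})}`; King's `S^{(k−1),R(5^kε)}` is `Srot m (k−1)` since
`Z^{R(5ε_K)} = Z^{R(ε_{K−1})}`), `SrotHat m j` ↤ the switched construction from `Z^{R(ε_{m+j})}`; `Zst K` ↤ `Z^{ε_K}(D_J, g, h)`,
`Zrot K` ↤ `Z^{R(ε_K)}(D_J, g, h)`; `vol` ↤ `|D_J|`; `b₀, p` ↤ the constants of `p(ε)` ([K I] (3.1)).  ABSTRACT SCHEMA: none of
these objects is constructed here; `g, h` (real sources) and `d = 2, 3` are fixed parameters. [cite: King1986II, pp.336–337] -/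
structure RotData (X Y : ℕ → Type*) [∀ m, MeasurableSpace (X m)] [∀ m, MeasurableSpace (Y m)] where
  /-- `|D_J|` -/
  vol : ℝ
  /-- the constants of `p(ε) = b₀(1 + log ε⁻¹)^p` -/
  b₀ : ℝ
  p : ℝ
  /-- `(dA_k)(dφ_k)` on the rotated unit lattices -/
  μX : ∀ m, Measure (X m)
  /-- `χ_k(A_k)χ_k(φ_k)` there -/
  chiX : ∀ m, X m → ℝ
  /-- `(dA_k)(dφ_k)` on the axis unit lattices -/
  μY : ∀ m, Measure (Y m)
  chiY : ∀ m, Y m → ℝ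
  /-- `S^{(k),st}` from `Z^ε`, usual blocks -/
  Sst : ∀ m, ℕ → Y m → ℝ
  /-- `Ŝ^{(k),R(5^kε)}` from `Z^ε`, first block rotated ((4.3)–(4.4)) -/
  SstHat : ∀ m, ℕ → X m → ℝ
  /-- `S^{(j),R}` from `Z^{R(·)}`, usual blocks -/
  Srot : ∀ m, ℕ → X m → ℝ
  /-- the switched construction from `Z^{R(·)}` (p. 337) -/
  SrotHat : ∀ m, ℕ → Y m → ℝ
  /-- `Z^{ε_K}(D_J, g, h)` -/
  Zst : ℕ → ℝ
  /-- `Z^{R(ε_K)}(D_J, g, h)` -/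
  Zrot : ℕ → ℝ

namespace RotData

variable {X Y : ℕ → Type*} [∀ m, MeasurableSpace (X m)] [∀ m, MeasurableSpace (Y m)] (D : RotData X Y)

/-- The axis model as [K I] renormalization-group data (`L = 5`): p. 336 *"The results of [Ba 1–4] apply to both these models"*,
so [K I]'s `Thm31Printed`, `Thm34Printed`, `UVStable` are stated for it BY NAME. [cite: King1986II, (4.2) p.336; King1986, Thm 3.1 p.655] -/
def std : RGData Y :=
  { L := 5, vol := D.vol, b₀ := D.b₀, p := D.p, μ := D.μY, chi := D.chiY, S := D.Sst, Z := D.Zst }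

/-- The rotated model as [K I] renormalization-group data (`L = 5`). [cite: King1986II, (4.2) p.336; King1986, Thm 3.1 p.655] -/
def rot : RGData X :=
  { L := 5, vol := D.vol, b₀ := D.b₀, p := D.p, μ := D.μX, chi := D.chiX, S := D.Srot, Z := D.Zrot }

/-- `L = 5` for the axis model. [cite: King1986II, p.327] -/
@[simp] theorem std_L : D.std.L = 5 := rfl
/-- `L = 5` for the rotated model. [cite: King1986II, p.327] -/
@[simp] theorem rot_L : D.rot.L = 5 := rfl
/-- projection. [cite: King1986II, p.336] -/
@[simp] theorem std_Z : D.std.Z = D.Zst := rfl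
/-- projection. [cite: King1986II, p.336] -/
@[simp] theorem rot_Z : D.rot.Z = D.Zrot := rfl
/-- projection. [cite: King1986II, p.336] -/
@[simp] theorem std_vol : D.std.vol = D.vol := rfl
/-- projection. [cite: King1986II, p.336] -/
@[simp] theorem rot_vol : D.rot.vol = D.vol := rfl
/-- projection. [cite: King1986II, p.336] -/
@[simp] theorem std_chi : D.std.chi = D.chiY := rfl
/-- projection. [cite: King1986II, p.336] -/
@[simp] theorem rot_chi : D.rot.chi = D.chiX := rfl
/-- projection. [cite: King1986II, p.336] -/
@[simp] theorem std_S : D.std.S = D.Sst := rfl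
/-- projection. [cite: King1986II, p.336] -/
@[simp] theorem rot_S : D.rot.S = D.Srot := rfl
/-- projection. [cite: King1986II, p.336] -/
@[simp] theorem std_μ : D.std.μ = D.μY := rfl
/-- projection. [cite: King1986II, p.336] -/
@[simp] theorem rot_μ : D.rot.μ = D.μX := rfl
/-- projection. [cite: King1986II, p.336] -/
@[simp] theorem std_b₀ : D.std.b₀ = D.b₀ := rfl
/-- projection. [cite: King1986II, p.336] -/
@[simp] theorem rot_b₀ : D.rot.b₀ = D.b₀ := rfl
/-- projection. [cite: King1986II, p.336] -/
@[simp] theorem std_p : D.std.p = D.p := rfl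
/-- projection. [cite: King1986II, p.336] -/
@[simp] theorem rot_p : D.rot.p = D.p := rfl

/-- **(4.2)** p. 336 [PDF 14], verbatim: *"The results of [Ba 1–4] apply to both these models, and we have e^{−C₁|D_J|} ≤
Z^ε(D_J, g, h), Z^{R(ε)}(D_J, g, h) ≤ e^{C₂|D_J|}, (4.2) where C₁, C₂ depend on g, h but not on ε or J."*  (for the lattices
`ε = ε_K`; HYPOTHESIS SCHEMA). [cite: King1986II, (4.2) p.336] -/
def UV42 : Prop :=
  ∃ C₁ C₂ : ℝ, ∀ K : ℕ, (Real.exp (-(C₁ * D.vol)) ≤ D.Zst K ∧ D.Zst K ≤ Real.exp (C₂ * D.vol)) ∧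
    (Real.exp (-(C₁ * D.vol)) ≤ D.Zrot K ∧ D.Zrot K ≤ Real.exp (C₂ * D.vol))

/-- (4.2) gives [K I]'s `UVStable` for the axis model. [cite: King1986II, (4.2) p.336] -/
theorem uvStable_std_of_uv42 (h : D.UV42) : D.std.UVStable := by
  obtain ⟨C₁, C₂, h⟩ := h
  exact ⟨C₁, C₂, fun K => (h K).1⟩

/-- (4.2) gives [K I]'s `UVStable` for the rotated model. [cite: King1986II, (4.2) p.336] -/
theorem uvStable_rot_of_uv42 (h : D.UV42) : D.rot.UVStable := by
  obtain ⟨C₁, C₂, h⟩ := h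
  exact ⟨C₁, C₂, fun K => (h K).2⟩

/-- The small-field integral on the right of (4.5): `∫(dA)(dφ)χ_k(A_k)χ_k(φ_k) exp[−Ŝ^{(k),R(5^kε)}(T^{(k)}, A_k, φ_k, g, h) +
C(L^kε)^σ|D_J|]`, `L^kε = ε_m`. [cite: King1986II, (4.5) p.336] -/
def hatIntegralX (C σ : ℝ) (m k : ℕ) : ℝ :=
  ∫ x, D.chiX m x * Real.exp (-(D.SstHat m k x) + C * (eps 5 m) ^ σ * D.vol) ∂(D.μX m)

/-- The mirror small-field integral (switched argument, p. 337). [cite: King1986II, p.337] -/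
def hatIntegralY (C σ : ℝ) (m j : ℕ) : ℝ :=
  ∫ y, D.chiY m y * Real.exp (-(D.SrotHat m j y) + C * (eps 5 m) ^ σ * D.vol) ∂(D.μY m)

/-- **PROPOSITION 4.1** p. 336 [PDF 14], verbatim: *"In Sect. 5 we will prove the following proposition. **Proposition 4.1.**
Z^ε(D_J, g, h) ≥ ∫(dA)(dφ)χ_k(A_k)χ_k(φ_k)·exp[−Ŝ^{(k),R(5^kε)}(T^{(k)}, A_k, φ_k, g, h) + C(L^kε)^σ|D_J|] (4.5) for 0 ≤ k ≤ K,
σ > 0 and χ_k as defined in Sect. 3 of [K 1]."*  In the `(m, k)` indexing (`ε = ε_{m+k}`).  HYPOTHESIS SCHEMA (proved in Sect. 5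
of [K II], not reproduced). [cite: King1986II, Prop 4.1 (4.5) p.336] -/
def Prop41Printed : Prop :=
  ∃ σ C : ℝ, 0 < σ ∧ ∀ m k : ℕ, D.hatIntegralX C σ m k ≤ D.Zst (m + k)

/-- **THEOREM 4.2** p. 337 [PDF 15], verbatim: *"**Theorem 4.2.** χ_k(A_k)χ_k(φ_k)|Ŝ^{(k),1}(T^{(k)}, A_k, φ_k, g, h) −
S^{(k−1),1}(T^{(k)}, A_k, φ_k, g, h)| ≤ C(L^{−γk}(L^kε)^{−β} + (L^kε)^σ)|D_J|, (4.6) where 0 < γ < 1, 0 < σ, β, and c depends on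
g, h. Proof. The proof is almost identical to the proof of Theorem 3.4 in [K 1], assuming that we have corresponding results on
convergence of propagators. These results will be established in Appendix B."*  Written with `k = j + 1 ≥ 1` (`Ŝ^{(j+1)}` vs
`S^{(j),R}`, both on `X m`; `L = 5`, `L^kε = ε_m`).  HYPOTHESIS SCHEMA. [cite: King1986II, Thm 4.2 (4.6) p.337] -/
def Thm42Printed : Prop :=
  ∃ γ σ β C : ℝ, 0 < γ ∧ γ < 1 ∧ 0 < σ ∧ 0 < β ∧ ∀ (m j : ℕ) (x : X m),
    D.chiX m x * |D.SstHat m (j + 1) x - D.Srot m j x|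
      ≤ C * ((5 : ℝ) ^ (-(γ * ((j + 1 : ℕ) : ℝ))) * (eps 5 m) ^ (-β) + (eps 5 m) ^ σ) * D.vol

/-- The *"analogue of Proposition 4.1"* of the switched argument, p. 337 [PDF 15]: *"To complete the proof, we must prove the
same bound for {Z^ε(D_J, g, h) − Z^{R(5ε)}(D_J, g, h)}. We do this by switching around the argument; rotated blocks are used to
generate from Z^{R(5ε)}(D_J, g, h) an effective action on the lattice T^{(1)}_{5²ε}, and other actions on T^{(k−1)}_{5^kε}. These
are compared with the actions generated from Z^ε(D_J, g, h) by the usual transformations. We can prove analogues of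
Proposition 4.1 and Theorem 4.2, which is all we need."*: `Z^{R(ε_{m+j})} ≥ ∫χχ exp[−Ŝ^{rot,(j)} + C ε_m^σ|D_J|]`.  HYPOTHESIS
SCHEMA (stated, not printed as a display). [cite: King1986II, p.337] -/
def Prop41Mirror : Prop :=
  ∃ σ C : ℝ, 0 < σ ∧ ∀ m j : ℕ, D.hatIntegralY C σ m j ≤ D.Zrot (m + j)

/-- The *"analogue of Theorem 4.2"* of the switched argument (p. 337): on the axis unit lattice `Y m`,
`χ|Ŝ^{rot,(j)} − S^{(j+1),st}| ≤ C(L^{−γ(j+1)}ε_m^{−β} + ε_m^σ)|D_J|` (rate indexed, as in (4.6), by the step count `j + 1` of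
the finer model).  HYPOTHESIS SCHEMA (stated, not printed as a display). [cite: King1986II, p.337, Thm 4.2 (4.6) p.337] -/
def Thm42Mirror : Prop :=
  ∃ γ σ β C : ℝ, 0 < γ ∧ γ < 1 ∧ 0 < σ ∧ 0 < β ∧ ∀ (m j : ℕ) (y : Y m),
    D.chiY m y * |D.SrotHat m j y - D.Sst m (j + 1) y|
      ≤ C * ((5 : ℝ) ^ (-(γ * ((j + 1 : ℕ) : ℝ))) * (eps 5 m) ^ (-β) + (eps 5 m) ^ σ) * D.vol

/-- The standing side conditions of pp. 336–337 made explicit: `b₀ > 0`, `p ≥ 1` ([K I] (3.1): *"p is a small integer and b₀ is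
a constant O(1)"*), `|D_J| ≥ 0`, `χ_k(A_k)χ_k(φ_k) ∈ {0, 1}` ([K I] (3.2): *"the function which is one when all the following
inequalities hold and zero otherwise"*), and finiteness of the small-field integrals. [cite: King1986II, pp.336–337; King1986, (3.1)–(3.2) p.655] -/
structure Regular : Prop where
  b₀_pos : 0 < D.b₀
  one_le_p : 1 ≤ D.p
  vol_nonneg : 0 ≤ D.vol
  chiX01 : ∀ m x, D.chiX m x = 0 ∨ D.chiX m x = 1
  chiY01 : ∀ m y, D.chiY m y = 0 ∨ D.chiY m y = 1
  finSrot : ∀ (C σ : ℝ) (m k : ℕ),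
    Integrable (fun x => D.chiX m x * Real.exp (-(D.Srot m k x) + C * (eps 5 m) ^ σ * D.vol)) (D.μX m)
  finSstHat : ∀ (C σ : ℝ) (m k : ℕ),
    Integrable (fun x => D.chiX m x * Real.exp (-(D.SstHat m k x) + C * (eps 5 m) ^ σ * D.vol)) (D.μX m)
  finSst : ∀ (C σ : ℝ) (m k : ℕ),
    Integrable (fun y => D.chiY m y * Real.exp (-(D.Sst m k y) + C * (eps 5 m) ^ σ * D.vol)) (D.μY m)
  finSrotHat : ∀ (C σ : ℝ) (m k : ℕ),
    Integrable (fun y => D.chiY m y * Real.exp (-(D.SrotHat m k y) + C * (eps 5 m) ^ σ * D.vol)) (D.μY m)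

/-- **(4.7)–(4.9) with «choosing k suitably», PROVED over the schema**: from [K I] Theorem 3.1 for the rotated model,
Proposition 4.1, Theorem 4.2 and (4.2): `Z^{R(5ε_{n+1})}(D_J, g, h) − Z^{ε_{n+1}}(D_J, g, h) = Zrot n − Zst (n+1) ≤ Bc·5^{−a(n+1)}`
for `n ≥ n₀`, some `a > 0`. [cite: King1986II, (4.7)–(4.9) p.337] -/
theorem rot_sub_std_le (hR : D.Regular) (h31 : D.rot.Thm31Printed) (h41 : D.Prop41Printed)
    (h42 : D.Thm42Printed) (hUV : D.UV42) :
    ∃ (a Bc : ℝ) (n₀ : ℕ), 0 < a ∧ 0 ≤ Bc ∧ ∀ n : ℕ, n₀ ≤ n →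
      D.Zrot n - D.Zst (n + 1) ≤ Bc * (5 : ℝ) ^ (-(a * ((n + 1 : ℕ) : ℝ))) := by
  obtain ⟨C₁, C₂, hUV'⟩ := hUV
  have h := Core.oneSided D.rot D.SstHat D.Zst 1 0 (by simp) hR.b₀_pos hR.one_le_p hR.vol_nonneg
    hR.chiX01 hR.finSrot hR.finSstHat h31 h41
    (by
      obtain ⟨γ, σ, β, C, hγ, hγ1, hσ, hβ, h⟩ := h42
      exact ⟨γ, σ, β, C, hγ, hγ1, hσ, hβ, fun m j x => by simpa using h m j x⟩)
    ⟨C₂, fun K => (hUV' K).1.2⟩ ⟨C₂, fun K => (hUV' K).2.2⟩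
  simpa using h

/-- **«Switching around the argument»** (p. 337), PROVED over the schema: from [K I] Theorem 3.1 for the axis model and the
mirror analogues, `Z^{ε_{n+1}} − Z^{R(5ε_{n+1})} = Zst (n+1) − Zrot n ≤ Bc·5^{−a(n+1)}` for `n ≥ n₀`. [cite: King1986II, p.337] -/
theorem std_sub_rot_le (hR : D.Regular) (h31 : D.std.Thm31Printed) (h41 : D.Prop41Mirror)
    (h42 : D.Thm42Mirror) (hUV : D.UV42) :
    ∃ (a Bc : ℝ) (n₀ : ℕ), 0 < a ∧ 0 ≤ Bc ∧ ∀ n : ℕ, n₀ ≤ n →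
      D.Zst (n + 1) - D.Zrot n ≤ Bc * (5 : ℝ) ^ (-(a * ((n + 1 : ℕ) : ℝ))) := by
  obtain ⟨C₁, C₂, hUV'⟩ := hUV
  have h := Core.oneSided D.std D.SrotHat D.Zrot 0 1 (by simp) hR.b₀_pos hR.one_le_p hR.vol_nonneg
    hR.chiY01 hR.finSst hR.finSrotHat h31 h41
    (by
      obtain ⟨γ, σ, β, C, hγ, hγ1, hσ, hβ, h⟩ := h42
      exact ⟨γ, σ, β, C, hγ, hγ1, hσ, hβ, fun m j y => by simpa using h m j y⟩)
    ⟨C₂, fun K => (hUV' K).2.2⟩ ⟨C₂, fun K => (hUV' K).1.2⟩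
  simpa using h

/-- **Both directions**: `|Z^{R(5ε_{n+1})}(D_J, g, h) − Z^{ε_{n+1}}(D_J, g, h)| ≤ Bc·5^{−a(n+1)}` for `n ≥ n₀` (p. 337: *"which is
all we need"*). [cite: King1986II, (4.9) p.337] -/
theorem abs_rot_sub_std_le (hR : D.Regular) (h31s : D.std.Thm31Printed) (h31r : D.rot.Thm31Printed)
    (h41 : D.Prop41Printed) (h42 : D.Thm42Printed) (h41m : D.Prop41Mirror) (h42m : D.Thm42Mirror)
    (hUV : D.UV42) :
    ∃ (a Bc : ℝ) (n₀ : ℕ), 0 < a ∧ 0 ≤ Bc ∧ ∀ n : ℕ, n₀ ≤ n →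
      |D.Zrot n - D.Zst (n + 1)| ≤ Bc * (5 : ℝ) ^ (-(a * ((n + 1 : ℕ) : ℝ))) := by
  obtain ⟨a₁, B₁, n₁, ha₁, hB₁, h₁⟩ := D.rot_sub_std_le hR h31r h41 h42 hUV
  obtain ⟨a₂, B₂, n₂, ha₂, hB₂, h₂⟩ := D.std_sub_rot_le hR h31s h41m h42m hUV
  refine ⟨min a₁ a₂, B₁ + B₂, max n₁ n₂, lt_min ha₁ ha₂, by positivity, fun n hn => ?_⟩
  have h5 : (1 : ℝ) ≤ 5 := by norm_num
  have hg₁ : (5 : ℝ) ^ (-(a₁ * ((n + 1 : ℕ) : ℝ))) ≤ (5 : ℝ) ^ (-(min a₁ a₂ * ((n + 1 : ℕ) : ℝ))) :=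
    rpow_neg_mul_le h5 (min_le_left _ _) (n + 1)
  have hg₂ : (5 : ℝ) ^ (-(a₂ * ((n + 1 : ℕ) : ℝ))) ≤ (5 : ℝ) ^ (-(min a₁ a₂ * ((n + 1 : ℕ) : ℝ))) :=
    rpow_neg_mul_le h5 (min_le_right _ _) (n + 1)
  have hG0 : 0 ≤ (5 : ℝ) ^ (-(min a₁ a₂ * ((n + 1 : ℕ) : ℝ))) := Real.rpow_nonneg (by norm_num) _
  have e₁ := h₁ n (le_trans (le_max_left _ _) hn)
  have e₂ := h₂ n (le_trans (le_max_right _ _) hn)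
  rw [abs_le]
  constructor
  · nlinarith [mul_le_mul_of_nonneg_left hg₂ hB₂]
  · nlinarith [mul_le_mul_of_nonneg_left hg₁ hB₁]

/-- **`Z^{R(5ε_K)}(D_J, g, h) − Z^{ε_K}(D_J, g, h) → 0`** as `K → ∞` (p. 337: *"Then using the bound (4.9) and choosing k suitably,
Theorem 2.4 follows (see Sect. 3.2 of [K 1])"*), PROVED over the schema. [cite: King1986II, (4.9) p.337] -/
theorem tendsto_rot_sub_std (hR : D.Regular) (h31s : D.std.Thm31Printed) (h31r : D.rot.Thm31Printed)
    (h41 : D.Prop41Printed) (h42 : D.Thm42Printed) (h41m : D.Prop41Mirror) (h42m : D.Thm42Mirror)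
    (hUV : D.UV42) :
    Tendsto (fun n => D.Zrot n - D.Zst (n + 1)) atTop (𝓝 0) := by
  obtain ⟨a, Bc, n₀, ha, hBc, h⟩ := D.abs_rot_sub_std_le hR h31s h31r h41 h42 h41m h42m hUV
  have h5 : (1 : ℝ) < 5 := by norm_num
  have hgeo : Tendsto (fun n : ℕ => Bc * ((5 : ℝ) ^ (-a)) ^ (n + 1)) atTop (𝓝 0) := by
    have h1 : Tendsto (fun n : ℕ => ((5 : ℝ) ^ (-a)) ^ n) atTop (𝓝 0) :=
      tendsto_pow_atTop_nhds_zero_of_lt_one (rpow_neg_lt_one h5 ha).1 (rpow_neg_lt_one h5 ha).2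
    have h2 := (h1.comp (tendsto_add_atTop_nat 1)).const_mul Bc
    simpa using h2
  refine Metric.tendsto_atTop.2 fun ε hε => ?_
  obtain ⟨N₁, hN₁⟩ := Metric.tendsto_atTop.1 hgeo ε hε
  refine ⟨max N₁ n₀, fun n hn => ?_⟩
  have hb := h n (le_trans (le_max_right _ _) hn)
  have hc := hN₁ n (le_trans (le_max_left _ _) hn)
  rw [Real.dist_eq, sub_zero] at hc ⊢
  have hrw : (5 : ℝ) ^ (-(a * ((n + 1 : ℕ) : ℝ))) = ((5 : ℝ) ^ (-a)) ^ (n + 1) := by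
    rw [← rpow_neg_mul_natCast (by norm_num : (0 : ℝ) < 5) a (n + 1)]
  rw [hrw] at hb
  exact lt_of_le_of_lt hb (lt_of_le_of_lt (le_abs_self _) hc)

/-- **(2.22) AT THE LEVEL OF THE GENERATING FUNCTIONALS, PROVED over the schema**: if `Z^{ε_K}(D_J, g, h) → Z` ([K I] Theorem 2.1
(i) on the torus `D_J`) then also `Z^{R(ε_K)}(D_J, g, h) → Z`. [cite: King1986II, Thm 2.4 (2.22) p.327, p.337] -/
theorem tendsto_rot_of_tendsto_std (hR : D.Regular) (h31s : D.std.Thm31Printed) (h31r : D.rot.Thm31Printed)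
    (h41 : D.Prop41Printed) (h42 : D.Thm42Printed) (h41m : D.Prop41Mirror) (h42m : D.Thm42Mirror)
    (hUV : D.UV42) {Zlim : ℝ} (hlim : Tendsto D.Zst atTop (𝓝 Zlim)) :
    Tendsto D.Zrot atTop (𝓝 Zlim) := by
  have h1 := D.tendsto_rot_sub_std hR h31s h31r h41 h42 h41m h42m hUV
  have h2 : Tendsto (fun n => D.Zst (n + 1)) atTop (𝓝 Zlim) := hlim.comp (tendsto_add_atTop_nat 1)
  have h3 := h1.add h2
  simp only [zero_add, sub_add_cancel] at h3
  exact h3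

/-- **The two limits of (2.22) exist and agree, for the generating functionals, PROVED over the schema** — adding [K I] Theorem
3.4 for the axis model on `D_J` (FILE A's `RGData.hasContinuumLimit_of_thm31_thm34` = [K I] pp. 656–657 gives the existence of
`lim Z^{ε_K}(D_J, g, h)`): `∃ Z, Z^{ε_K}(D_J, g, h) → Z ∧ Z^{R(ε_K)}(D_J, g, h) → Z`.
[cite: King1986II, Thm 2.4 (2.22) p.327, p.337; King1986, Thm 2.1 p.654] -/
theorem limits_agree (hR : D.Regular) (h31s : D.std.Thm31Printed) (h31r : D.rot.Thm31Printed)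
    (h34s : D.std.Thm34Printed)
    (h41 : D.Prop41Printed) (h42 : D.Thm42Printed) (h41m : D.Prop41Mirror) (h42m : D.Thm42Mirror)
    (hUV : D.UV42) :
    ∃ Zlim : ℝ, Tendsto D.Zst atTop (𝓝 Zlim) ∧ Tendsto D.Zrot atTop (𝓝 Zlim) := by
  have hcl : HasContinuumLimit D.std.Z :=
    D.std.hasContinuumLimit_of_thm31_thm34 (by simp) hR.b₀_pos hR.one_le_p hR.vol_nonneg hR.chiY01
      hR.finSst h31s h34s (D.uvStable_std_of_uv42 hUV)
  obtain ⟨Zlim, hZ⟩ := hcl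
  exact ⟨Zlim, hZ, D.tendsto_rot_of_tendsto_std hR h31s h31r h41 h42 h41m h42m hUV hZ⟩

/-- By (4.2) the limit of the generating functionals is positive (`≥ e^{−C₁|D_J|}`), so expectations — ratios of generating
functionals, (2.10) — pass to the limit. [cite: King1986II, (4.2) p.336, (2.10) p.325] -/
theorem limit_pos_of_uv42 (hUV : D.UV42) {Zlim : ℝ} (hlim : Tendsto D.Zst atTop (𝓝 Zlim)) : 0 < Zlim := by
  obtain ⟨C₁, C₂, h⟩ := hUV
  have hge : Real.exp (-(C₁ * D.vol)) ≤ Zlim :=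
    ge_of_tendsto' hlim fun K => (h K).1.1
  exact lt_of_lt_of_le (Real.exp_pos _) hge

end RotData

/-- **From generating functionals to expectations** ((2.10): `⟨O⟩ = Z(g, h)/Z(0, 0)` for real sources): if numerators and
denominators of the two orientations converge to common limits `ν` and `δ ≠ 0`, the expectations (2.20) and (2.21) converge
to the common value `ν/δ`. [cite: King1986II, (2.10) p.325, Thm 2.4 (2.22) p.327] -/
theorem expectations_agree {N Nr Dn Dr : ℕ → ℝ} {ν δ : ℝ} (hδ : δ ≠ 0)
    (hN : Tendsto N atTop (𝓝 ν)) (hNr : Tendsto Nr atTop (𝓝 ν))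
    (hD : Tendsto Dn atTop (𝓝 δ)) (hDr : Tendsto Dr atTop (𝓝 δ)) :
    Tendsto (fun K => N K / Dn K) atTop (𝓝 (ν / δ)) ∧ Tendsto (fun K => Nr K / Dr K) atTop (𝓝 (ν / δ)) :=
  ⟨hN.div hD hδ, hNr.div hDr hδ⟩

end Literature.MathematicalPhysics.QuantumFieldTheory.King1986.RotationInvariance

end
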